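import Summits.QuantumFields.YangMills.Theorems.UnitScaleTiltProp7CentrePinnedHessianPoincareCov
import Summits.QuantumFields.YangMills.Theorems.UnitScaleTiltProp7LemmaHCurvedFramesOfRegPr
import HarnessLib

/-!
# Route `UnitScaleTilt`, crux K1 «MinimiserStabilityRegPr» (stmt-QuantumFields-19200), route-R E′ path (α′), S2 = P-cov2 ∕ (E1-b) covariant, brick (D1-cov) — THE MEMBER DISCHARGE
# OF THE FRAMES: the displayed `hframes` of ✓ `Prop7CentrePinnedHessianPoincareCov.sum_hs_le_rows` ∕ `sum_hs_le_covLaplace_hs` (a bi-contractive frame per 13-cell window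
# `Q_{5ℓ_k+1}(c₀ + ℓ_k t)` whose framed links obey the size rows `τ₁` and the MIXED transverse-difference row `τ₂`) HOLDS at the member of record for every `W ∈ RegPr`
# (print's regime `M·α₀ ≤ a₅`), with `τ₁ = ηC′e^{ηC′} ≍ α₀∕ℓ_k`, `τ₂ = η(ηC′)e^{ηC′} ≍ α₀∕ℓ_k²` — so (D1-cov)'s window `ℓ_k⁴·(4Na² + (2τ₂ + 4τ₁²)²)` is `ℓ_k`-FREE

Cell `ym3-torus`, width seat `ym3-torus-px4` (gen 3), answering ym-routeR-w6 g6's HANDOFF § INTERIM 1 (2026-08-28T21:08Z) «member discharge of (D1-cov)'s frames = routeR-w4 F-H7b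
pattern on 13-cell windows (any hand)».  THEOREMS ONLY (0 `def`, 0 `sorry`); `--supports stmt-QuantumFields-19200`, count-neutral.  YM₃ on T³ is a ladder rung (R3), not the
Clay problem; nothing here claims a stub, the crux, d = 4 or the mass gap.

THE CHAIN, ALL BY NAME (ym-routeR-w4 g9's F-H7 kit, re-aimed at the 13-cell windows): ✓ `Prop7SectET3ClassTransfer.reg335_reg336_T3_of_regPr` ([Balaban1985RegularSpaces] (1.33)
second clause at the member `memberIdx`) ⟹ (✓ `reg335_bgT3_iff`) r06's `Reg335Cube` on every cube of the member's class `cubeClass396` ⟹ [§2 `exists_gridCube_cover_box`: the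
integer window `Q_{5ℓ_k+1}(c₀ + ℓ_kt)` read mod `N` together with its `{0,1,2}³`-neighbours sits in ONE aligned cube `torusCube c (2·bigSide)` (`bigSide ≥ 40ℓ_k ≥ 10ℓ_k + 6`,
§3 `bigSide_ge_window`), which is a class cube by ✓ `gridCube_mem_cubeClass396`] ⟹ §1 `frame_rows_of_reg335Cube_mixed` (the (3.35) dictionary of ✓ `Prop7ConjFrameReg335` with the
gradient clause read for ALL pairs `(κ, μ)`, not only the diagonal) ⟹ the frame `u⁻¹` on the cube, `1` outside (`piecewiseFrame_bicontr`, `piecewiseFrameHol_eq`).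
WHY A (3.35) CUBE GAUGE AND NOT A COMB: (D1-cov)'s window needs `ℓ_k⁴τ₂² = O(e²)`, i.e. `τ₂ ≍ ℓ_k⁻²`; an axial comb gives transverse differences `≍ ℓ_k·a ≍ e∕ℓ_k` only
(ym-routeR-w4 g9 LOCATE-FH3: «comb frames' Laplacian row = [div A^ax, m], NOT one plaquette») — (3.35)'s `|∇^ηA| < O(1)Mα₀(L^jη)⁻²` is exactly the missing order.

WHAT IS PROVED (ns `…Theorems.Prop7CentrePinnedHessianPoincareCovFrames`).
* §1 (abstract carrier of `B9Eq39Adjoint`) ★★ `frame_rows_of_reg335Cube_mixed` — from `Reg335Cube T U η cube ξ C` (`0 < η`): a gauge `u`, bi-contractive on the cube, with SIZE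
  `‖(U^u)_μ(x) − 1‖ ≤ η(Cξ⁻¹)e^{η(Cξ⁻¹)}` on the cube and MIXED FORWARD DIFFERENCE `‖(U^u)_μ(x + e_κ) − (U^u)_μ(x)‖ ≤ η(η(C(ξ²)⁻¹))e^{η(Cξ⁻¹)}` for all `κ, μ` (`x, x + e_κ` in the cube);
  `piecewiseFrameHol_eq`, `piecewiseFrame_bicontr` (the frame `u⁻¹` on the cube, `1` outside).
* §2 (generic `P`) `torusT_intCast` (`(z mod N) + e_μ = (z + e_μ) mod N`), ★ `exists_gridCube_cover_box` (`0 < B`, `B ∣ N`, `2B ≤ N`, `2R + 4 ≤ B` ⇒ every `Q_R(m) ⊂ ℤ^d` with its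
  `{0,1,2}^d`-neighbours, read mod `N`, lies in one `torusCube c (2B)` with `B ∣ c`).
* §3 (the member `PV 2 ℓ m K`, `k = K − n`, `U = unitsField (toUField W)`, SU(2)) `bigSide_ge_window`, `unitVec_mem`, `unitVec_add_mem`, ★★★ `hframes_of_regPr` — `∃ c35 a₅ > 0, ∀ member,
  ∀ α₀ > 0, M·α₀ ≤ a₅ → ∀ W, RegPr → ∀ t, ∃ Fr, (bi-contractive) ∧ (the four rows of `hframes` VERBATIM with `τ₁ τ₂` as above)`, and ★★★ `sum_hs_le_covLaplace_hs_of_regPr` =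
  ✓ `sum_hs_le_covLaplace_hs` with `hU` (✓ `unitsField_mem_unitaryUnits`) and `hframes` DISCHARGED — displayed there remain only `hplaq` (the (6)(e) plaquette datum in `plaqU`
  letters), `he0` and the window `hwin`.
HONEST SCOPE.  Bookkeeping over landed bricks; the analytic input is [B8] Prop. 6 as consumed by ✓ `reg335_reg336_T3_of_regPr`; the smallness `M·α₀ ≤ a₅` is print's («for α₀
sufficiently small», [Balaban1985RegularSpaces] p.99).  (D1-cov) is ONE input of P-cov2 ∕ (E1-b)-covariant, not the row itself.

References: T. Bałaban, CMP 99 (1985) 75–102 [Balaban1985RegularSpaces] ((1.33) p.82, Prop. 6 p.99); CMP 99 (1985) 389–434 [Balaban1985BackgroundPropagators] ((3.28) p.395,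
(3.35) p.396); CMP 102 (1985) 277–309 [Balaban1985Variational] ((135) p.298, Prop. 7 p.299, Sect. A p.280); M. Giaquinta, *Multiple integrals in the calculus of variations and
nonlinear elliptic systems* (1983), Ch. III §1 [Giaquinta1984].
-/

set_option autoImplicit false

noncomputable section

open scoped Matrix.Norms.L2Operator

namespace Summit.QuantumFields.YangMills.Theorems.Prop7CentrePinnedHessianPoincareCovFrames

open Literature.MathematicalPhysics.QuantumFieldTheory.Balaban1983to89
open B9Eq39Adjoint (R covD fluct divB plaqU)
open B9Eq3117Current (gaugeTr)
open B9Eq335RegularityClasses (Reg335Cube)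
open B4Eq19LatticeOperators (Zd box mem_box unitVec unitVec_apply_self unitVec_apply_ne)
open B9TorusCalculus (torusT torusT_apply)
open B9BackgroundsKLevelV1 (torusCube)
open B9Thm310CommutatorDataOfPlaquettes (bicontr_inv)
open Summit.QuantumFields.YangMills.Theorems.Prop7ConjFrameReg335 (flatCovD_eq_sub norm_fluct_sub_one_le norm_fluct_sub_fluct_le frame_rows_of_reg335Cube)

/-! ## §1 The (3.35) dictionary with MIXED differences: `‖h_μ(x + e_κ) − h_μ(x)‖ ≤ η(ηC(ξ²)⁻¹)e^{ηCξ⁻¹}` for every pair `κ, μ` -/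

section Mixed

variable {𝔸 : Type} [NormedRing 𝔸] [NormedAlgebra ℂ 𝔸] [CompleteSpace 𝔸] [NormOneClass 𝔸] {S : Type*} {ι : Type*}
  (T : ι → Equiv.Perm S) (U : ι → S → 𝔸ˣ)

/-- ★★ **THE (3.35) DICTIONARY, MIXED FORM**: a (3.35) cube gauge `u` (scale `ξ`, constant `C`, spacing `η > 0`) is a frame whose holonomies `h_μ(x) = (U^u)_μ(x) = e^{iηA_μ(x)}`
satisfy on the cube the SIZE row `‖h_μ(x) − 1‖ ≤ η(Cξ⁻¹)e^{η(Cξ⁻¹)}` and, for EVERY direction `κ` with `x + e_κ` also in the cube, the MIXED FORWARD DIFFERENCE row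
`‖h_μ(x + e_κ) − h_μ(x)‖ ≤ η(η(C(ξ²)⁻¹))e^{η(Cξ⁻¹)}` — the clause `‖η⁻¹D¹_κA_μ‖ < C(ξ²)⁻¹` of (3.35) for ALL `κ, μ` (✓ `frame_rows_of_reg335Cube` exports the diagonal `κ = μ` only).
[cite: Balaban1985BackgroundPropagators, (3.35) p.396, (3.28) p.395] -/
theorem frame_rows_of_reg335Cube_mixed {η : ℝ} (hη : 0 < η) {cube : Set S} {ξ C : ℝ} (h : Reg335Cube T U η cube ξ C) :
    ∃ u : S → 𝔸ˣ, (∀ z ∈ cube, ‖(u z : 𝔸)‖ ≤ 1 ∧ ‖(((u z)⁻¹ : 𝔸ˣ) : 𝔸)‖ ≤ 1) ∧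
      (∀ (μ : ι), ∀ x ∈ cube, ‖((gaugeTr T u U μ x : 𝔸ˣ) : 𝔸) - 1‖ ≤ η * (C * ξ⁻¹) * Real.exp (η * (C * ξ⁻¹))) ∧
      (∀ (κ μ : ι), ∀ x ∈ cube, T κ x ∈ cube →
        ‖((gaugeTr T u U μ (T κ x) : 𝔸ˣ) : 𝔸) - ((gaugeTr T u U μ x : 𝔸ˣ) : 𝔸)‖
          ≤ η * (η * (C * (ξ ^ 2)⁻¹)) * Real.exp (η * (C * ξ⁻¹))) := by
  obtain ⟨u, A, hu, hg, hA, hD⟩ := h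
  refine ⟨u, hu, fun μ x hx => ?_, fun κ μ x hx hy => ?_⟩
  · rw [hg μ x hx]
    have hAx : ‖A μ x‖ ≤ C * ξ⁻¹ := (hA μ x hx).le
    have hCξ : 0 ≤ C * ξ⁻¹ := (norm_nonneg _).trans hAx
    calc _ ≤ η * ‖A μ x‖ * Real.exp (η * ‖A μ x‖) := norm_fluct_sub_one_le hη.le A μ x
      _ ≤ η * (C * ξ⁻¹) * Real.exp (η * (C * ξ⁻¹)) :=
          mul_le_mul (mul_le_mul_of_nonneg_left hAx hη.le) (Real.exp_le_exp.2 (mul_le_mul_of_nonneg_left hAx hη.le))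
            (Real.exp_pos _).le (mul_nonneg hη.le hCξ)
  · set y := T κ x with hy'
    rw [hg μ y hy, hg μ x hx]
    have hAx : ‖A μ x‖ ≤ C * ξ⁻¹ := (hA μ x hx).le
    have hAy : ‖A μ y‖ ≤ C * ξ⁻¹ := (hA μ y hy).le
    -- the flat-gradient clause at `(x, κ, μ)`: `‖η⁻¹ • (A μ (T κ x) − A μ x)‖ < C (ξ²)⁻¹`
    have hdiff : ‖A μ y - A μ x‖ ≤ η * (C * (ξ ^ 2)⁻¹) := by
      have h1 := hD κ μ x hx
      rw [flatCovD_eq_sub, norm_smul, norm_inv, Complex.norm_real, Real.norm_of_nonneg hη.le] at h1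
      exact ((inv_mul_lt_iff₀ hη).1 h1).le
    have hd0 : 0 ≤ η * (C * (ξ ^ 2)⁻¹) := (norm_nonneg _).trans hdiff
    calc _ ≤ η * ‖A μ y - A μ x‖ * Real.exp (η * max ‖A μ y‖ ‖A μ x‖) := norm_fluct_sub_fluct_le hη.le A μ y x
      _ ≤ η * (η * (C * (ξ ^ 2)⁻¹)) * Real.exp (η * (C * ξ⁻¹)) :=
          mul_le_mul (mul_le_mul_of_nonneg_left hdiff hη.le) (Real.exp_le_exp.2 (mul_le_mul_of_nonneg_left (max_le hAy hAx) hη.le))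
            (Real.exp_pos _).le (mul_nonneg hη.le hd0)

/-- With the piecewise frame `P z := if z ∈ cube then (u z)⁻¹ else 1` the frame holonomy at a bond inside the cube is `(U^u)_μ(x)`.
[cite: Balaban1985BackgroundPropagators, (3.28) p.395] -/
theorem piecewiseFrameHol_eq {𝔹 : Type*} [Ring 𝔹] {S' ι' : Type*} (T' : ι' → Equiv.Perm S') (U' : ι' → S' → 𝔹ˣ) (cube : Set S') [DecidablePred (· ∈ cube)]
    (u : S' → 𝔹ˣ) (μ : ι') (x : S') (hx : x ∈ cube) (hTx : T' μ x ∈ cube) :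
    ((fun z => if z ∈ cube then (u z)⁻¹ else 1) x)⁻¹ * U' μ x * (fun z => if z ∈ cube then (u z)⁻¹ else 1) (T' μ x) = gaugeTr T' u U' μ x := by
  simp only [hx, hTx, if_true, inv_inv, gaugeTr]

omit [NormedAlgebra ℂ 𝔸] [CompleteSpace 𝔸] in
/-- The piecewise frame is bi-contractive everywhere when `u` is bi-contractive on the cube. [folklore] -/
theorem piecewiseFrame_bicontr {S' : Type*} (cube : Set S') [DecidablePred (· ∈ cube)] (u : S' → 𝔸ˣ)
    (hu : ∀ z ∈ cube, ‖(u z : 𝔸)‖ ≤ 1 ∧ ‖(((u z)⁻¹ : 𝔸ˣ) : 𝔸)‖ ≤ 1) (z : S') :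
    ‖(((fun z => if z ∈ cube then (u z)⁻¹ else 1) z : 𝔸ˣ) : 𝔸)‖ ≤ 1 ∧
      ‖((((fun z => if z ∈ cube then (u z)⁻¹ else 1) z)⁻¹ : 𝔸ˣ) : 𝔸)‖ ≤ 1 := by
  by_cases hz : z ∈ cube
  · simp only [hz, if_true]
    exact bicontr_inv (hu z hz)
  · simp only [hz, if_false, inv_one, Units.val_one, norm_one]
    exact ⟨le_rfl, le_rfl⟩

end Mixed

/-! ## §2 The integer window `Q_R(m) ⊂ ℤ^d`, read mod the period, and its `+e`-neighbours sit in ONE aligned cube of side `2B` (`B ∣ N`, `2R + 4 ≤ B`, `2B ≤ N`) -/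

section Cover

variable {P : Params}

/-- A torus step of an integer point read mod `N`: `(z mod N) + e_μ = (z + e_μ) mod N`. [folklore] -/
theorem torusT_intCast (μ : Fin P.d) (z : Zd P.d) :
    torusT P 0 μ (fun κ => ((z κ : ℤ) : ZMod (P.sitesPerDir 0))) = fun κ => (((z + unitVec μ) κ : ℤ) : ZMod (P.sitesPerDir 0)) := by
  funext κ
  rw [torusT_apply, Site.shift]
  by_cases hκ : κ = μ
  · subst hκ
    rw [Function.update_self, Pi.add_apply, unitVec_apply_self]; push_cast; ring
  · rw [Function.update_of_ne hκ, Pi.add_apply, unitVec_apply_ne hκ, add_zero]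

/-- ★ **THE WINDOW COVER**: for `0 < B`, `B ∣ N`, `2B ≤ N` and `2R + 4 ≤ B`, every integer window `Q_R(m)` has an aligned corner `c` (`B ∣ c_μ`) such that `z + e` read mod `N` lies in
`torusCube c (2B)` for all `z ∈ Q_R(m)` and all `e ∈ {0,1,2}^d`. [cite: Balaban1985BackgroundPropagators, p.396 (the cube class), bookkeeping] -/
theorem exists_gridCube_cover_box (B : ℕ) (hB : 0 < B) (hBN : B ∣ P.sitesPerDir 0) (h2B : 2 * B ≤ P.sitesPerDir 0)
    (m : Zd P.d) (R : ℕ) (hR : 2 * R + 4 ≤ B) :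
    ∃ c : Site P 0, (∀ μ : Fin P.d, B ∣ (c μ).val) ∧
      ∀ z ∈ box m R, ∀ e : Zd P.d, (∀ κ, 0 ≤ e κ ∧ e κ ≤ 2) →
        (fun κ => (((z + e) κ : ℤ) : ZMod (P.sitesPerDir 0))) ∈ torusCube c (2 * B) := by
  set N := P.sitesPerDir 0 with hN
  haveI : NeZero N := ⟨P.sitesPerDir_ne_zero 0⟩
  -- the integer corner `q_κ := B·⌊(m_κ − R)∕B⌋`
  let q : Zd P.d := fun κ => (B : ℤ) * ((m κ - R) / (B : ℤ))
  have hq_le : ∀ κ, q κ ≤ m κ - R := fun κ => Int.mul_ediv_self_le (by exact_mod_cast hB.ne')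
  have hq_lt : ∀ κ, m κ - R < q κ + B := fun κ => by
    have := Int.lt_mul_ediv_self_add (x := m κ - R) (show (0 : ℤ) < B by exact_mod_cast hB)
    show m κ - ↑R < ↑B * ((m κ - ↑R) / ↑B) + ↑B
    linarith
  refine ⟨fun κ => ((q κ : ℤ) : ZMod N), fun κ => ?_, fun z hz e he => ?_⟩
  · -- `B ∣ (q_κ mod N)`
    have h1 : ((((q κ : ℤ) : ZMod N)).val : ℤ) = q κ % N := ZMod.val_intCast _
    have h2 : (B : ℤ) ∣ q κ % N := by
      have hBq : (B : ℤ) ∣ q κ := dvd_mul_right _ _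
      have hBN' : (B : ℤ) ∣ (N : ℤ) := by exact_mod_cast hBN
      rw [Int.emod_def]
      exact dvd_sub hBq (hBN'.mul_right _)
    exact Int.natCast_dvd_natCast.1 (h1 ▸ h2)
  · intro κ
    rw [mem_box] at hz
    have hzκ := hz κ
    obtain ⟨he0, he2⟩ := he κ
    -- `0 ≤ (z + e)_κ − q_κ < 2B`
    have hlow : 0 ≤ (z + e) κ - q κ := by
      have := abs_le.1 hzκ; simp only [Pi.add_apply]; linarith [hq_le κ]
    have hup : (z + e) κ - q κ < 2 * B := by
      have := abs_le.1 hzκ; simp only [Pi.add_apply]; linarith [hq_lt κ]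
    obtain ⟨w, hw⟩ := Int.eq_ofNat_of_zero_le hlow
    have hw2 : w < 2 * B := by exact_mod_cast (hw ▸ hup)
    show ((((z + e) κ : ℤ) : ZMod N) - ((q κ : ℤ) : ZMod N)).val < 2 * B
    rw [← Int.cast_sub, hw, Int.cast_natCast, ZMod.val_natCast, Nat.mod_eq_of_lt (by omega)]
    exact hw2

end Cover

/-! ## §3 ★★★ The member discharge: `hframes` of ✓ `Prop7CentrePinnedHessianPoincareCov.sum_hs_le_rows` from `RegPr` (print's regime `M·α₀ ≤ a₅`) -/

section Member

open Literature.MathematicalPhysics.QuantumFieldTheory.Balaban1983to89.T3ContinuumYM3Torus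
open Literature.MathematicalPhysics.QuantumFieldTheory.Balaban1983to89.T3PrintedRegularMinimiser (RegPr)
open Literature.MathematicalPhysics.QuantumFieldTheory.Balaban1983to89.B6KLevelCensusIndexV1 (KIdx kGeo)
open Literature.MathematicalPhysics.QuantumFieldTheory.Balaban1983to89.B6GlobalChartV1 (PV)
open B9BackgroundsKLevelV1 (cubeClass396 eta_pos_L_one_le_M_pos)
open B6MultiLevelBoxOperator (bigSide)
open B10Eq27TorusAxialLog (unitsField toUField)
open LatticeNorms (scaleLen)
open B15DeterminingSets (embIter)
open Summit.QuantumFields.YangMills.Theorems.Prop7CentrePinnedHessianPoincareCov (sum_hs_le_covLaplace_hs)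
open Summit.QuantumFields.YangMills.Theorems.Prop7SectET3Members (hd3 memberIdx hkw)
open Summit.QuantumFields.YangMills.Theorems.Prop7SectET3BgClass (bgT3 cfgV1OfT3 reg335_bgT3_iff eta_memberIdx M_memberIdx)
open Summit.QuantumFields.YangMills.Theorems.Prop7SectET3ClassTransfer (two_mul_side_add_two_le reg335_reg336_T3_of_regPr)
open Summit.QuantumFields.YangMills.Theorems.Prop7LemmaHCurvedFramesOfRegPr (bigSide_dvd_sitesPerDir gridCube_mem_cubeClass396 scaleLen_eta_memberIdx)

variable {ℓ : ℕ} {hL : Odd (ℓ + 1) ∧ 1 < ℓ + 1}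

/-- `2·(5·L^{K−n} + 1) + 4 ≤ bigSide = L^{a′}·L^{K−n}·L` (`L^{a′} ≥ 8`, `L ≥ 5`): a 13-cell window plus two steps fits in one big block. [cite: Balaban1985BackgroundPropagators, p.396 (bookkeeping)] -/
theorem bigSide_ge_window (hℓ : 4 ≤ ℓ) {K n a' : ℕ} (hM8 : 8 ≤ (ℓ + 1) ^ a') :
    2 * (5 * (ℓ + 1) ^ (K - n) + 1) + 4 ≤ bigSide ℓ ((ℓ + 1) ^ a') (K - n) := by
  unfold bigSide
  have hx : 1 ≤ (ℓ + 1) ^ (K - n) := Nat.one_le_pow _ _ (by omega)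
  rw [pow_succ]
  set x := (ℓ + 1) ^ (K - n)
  set a := (ℓ + 1) ^ a'
  have h1 : 8 * (x * 5) ≤ a * (x * (ℓ + 1)) := Nat.mul_le_mul hM8 (Nat.mul_le_mul_left x (by omega))
  omega

/-- entries of `e_μ` lie in `{0, 1}`. [folklore] -/
theorem unitVec_mem {d : ℕ} (μ κ : Fin d) : 0 ≤ unitVec μ κ ∧ unitVec μ κ ≤ 2 := by
  by_cases h : κ = μ
  · subst h; rw [unitVec_apply_self]; norm_num
  · rw [unitVec_apply_ne h]; norm_num

/-- entries of `e_ν + e_μ` lie in `{0, 1, 2}`. [folklore] -/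
theorem unitVec_add_mem {d : ℕ} (ν μ κ : Fin d) : 0 ≤ (unitVec ν + unitVec μ) κ ∧ (unitVec ν + unitVec μ) κ ≤ 2 := by
  have h1 := unitVec_mem ν κ
  have h2 := unitVec_mem μ κ
  rw [Pi.add_apply]
  by_cases hν : κ = ν
  · subst hν; rw [unitVec_apply_self] at h1 ⊢
    by_cases hμ : κ = μ
    · subst hμ; rw [unitVec_apply_self]; norm_num
    · rw [unitVec_apply_ne hμ]; norm_num
  · rw [unitVec_apply_ne hν, zero_add]; exact h2

/-- ★★★ **THE FRAMES OF (D1-cov) AT THE MEMBER OF RECORD, FROM `RegPr` ALONE.**  For odd `L = ℓ + 1 ≥ 5` there are `c35, a₅ > 0` (those of ✓ `reg335_reg336_T3_of_regPr`) such that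
for every member `(m, n, K, a′, R)`, every `α₀ > 0` with `M·α₀ ≤ a₅` (`M = L·L^{a′}`) and every `W ∈ RegPr`, the hypothesis `hframes` of ✓ `Prop7CentrePinnedHessianPoincareCov.sum_hs_le_rows`
∕ `sum_hs_le_covLaplace_hs` holds at `P := PV 2 ℓ m K`, `k := K − n`, `U := unitsField (toUField W)`, `N := 2`, with
`τ₁ := η·C′·e^{η·C′}`, `τ₂ := η·(η·C′)·e^{η·C′}`, `η = (L^{K−n})⁻¹`, `C′ = c35·(L·L^{a′})·α₀` (k-UNIFORM: `τ₁ ≍ α₀∕ℓ_k`, `τ₂ ≍ α₀∕ℓ_k²` — so (D1-cov)'s window `ℓ_k⁴·(2τ₂ + 4τ₁²)²`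
is `ℓ_k`-free): for every `t ∈ ℤ³` ONE (3.35) cube gauge on an aligned cube of side `2·bigSide ≥ 80·ℓ_k` containing the window `Q_{5ℓ_k+1}(c₀ + ℓ_kt)` and its `{0,1,2}³`-neighbours
(✓ `exists_gridCube_cover_box`, ✓ `gridCube_mem_cubeClass396`), extended by `1` outside.  [cite: Balaban1985RegularSpaces, (1.33) p.82, Prop. 6 p.99; Balaban1985BackgroundPropagators, (3.35) p.396;
Balaban1985Variational, Sect. A p.280] -/
theorem hframes_of_regPr (hℓ4 : 4 ≤ ℓ) :
    ∃ c35 a₅ : ℝ, 0 < c35 ∧ 0 < a₅ ∧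
      ∀ (hℓ : 4 ≤ ℓ) (m : ℕ) (hm : 1 ≤ m) (n K a' R : ℕ) (hk1 : 1 ≤ K - n) (hsize : a' + 3 ≤ m + n) (hM8 : 8 ≤ (ℓ + 1) ^ a')
        (hR2 : 2 * (ℓ + 1) ^ 2 ≤ R) (α₀ : ℝ), 0 < α₀ → ((ℓ + 1 : ℕ) : ℝ) * (((ℓ + 1) ^ a' : ℕ) : ℝ) * α₀ ≤ a₅ →
        ∀ W : GaugeField (PV 2 ℓ m K hd3 hL) 0 (Matrix.specialUnitaryGroup (Fin 2) ℂ),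
          RegPr (⟨ℓ + 1, hL, m, hm⟩ : T3Family) n K α₀ W →
          ∀ t : Zd (PV 2 ℓ m K hd3 hL).d, ∃ Fr : Site (PV 2 ℓ m K hd3 hL) 0 → (Matrix (Fin 2) (Fin 2) ℂ)ˣ,
            (∀ z : Site (PV 2 ℓ m K hd3 hL) 0, ‖(Fr z : Matrix (Fin 2) (Fin 2) ℂ)‖ ≤ 1 ∧ ‖(((Fr z)⁻¹ : (Matrix (Fin 2) (Fin 2) ℂ)ˣ) : Matrix (Fin 2) (Fin 2) ℂ)‖ ≤ 1) ∧
            ∀ z ∈ box (fun μ : Fin (PV 2 ℓ m K hd3 hL).d => ((((PV 2 ℓ m K hd3 hL).L ^ (K - n) - 1) / 2 : ℕ) : ℤ) + (((PV 2 ℓ m K hd3 hL).L ^ (K - n) : ℕ) : ℤ) * t μ)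
                (5 * (((PV 2 ℓ m K hd3 hL).L ^ (K - n) : ℕ) : ℤ) + 1), ∀ μ ν : Fin (PV 2 ℓ m K hd3 hL).d,
              ‖(((Fr (fun κ => ((z κ : ℤ) : ZMod ((PV 2 ℓ m K hd3 hL).sitesPerDir 0))))⁻¹
                  * unitsField (toUField W) ⟨(fun κ => ((z κ : ℤ) : ZMod ((PV 2 ℓ m K hd3 hL).sitesPerDir 0))), ν⟩
                  * Fr (torusT (PV 2 ℓ m K hd3 hL) 0 ν (fun κ => ((z κ : ℤ) : ZMod ((PV 2 ℓ m K hd3 hL).sitesPerDir 0)))) : (Matrix (Fin 2) (Fin 2) ℂ)ˣ) :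
                  Matrix (Fin 2) (Fin 2) ℂ) - 1‖
                ≤ (((ℓ + 1 : ℕ) : ℝ) ^ (K - n))⁻¹ * (c35 * (((ℓ + 1 : ℕ) : ℝ) * (((ℓ + 1) ^ a' : ℕ) : ℝ)) * α₀) * Real.exp ((((ℓ + 1 : ℕ) : ℝ) ^ (K - n))⁻¹ * (c35 * (((ℓ + 1 : ℕ) : ℝ) * (((ℓ + 1) ^ a' : ℕ) : ℝ)) * α₀))
              ∧ ‖(((Fr (fun κ => ((z κ : ℤ) : ZMod ((PV 2 ℓ m K hd3 hL).sitesPerDir 0))))⁻¹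
                  * unitsField (toUField W) ⟨(fun κ => ((z κ : ℤ) : ZMod ((PV 2 ℓ m K hd3 hL).sitesPerDir 0))), μ⟩
                  * Fr (torusT (PV 2 ℓ m K hd3 hL) 0 μ (fun κ => ((z κ : ℤ) : ZMod ((PV 2 ℓ m K hd3 hL).sitesPerDir 0)))) : (Matrix (Fin 2) (Fin 2) ℂ)ˣ) :
                  Matrix (Fin 2) (Fin 2) ℂ) - 1‖
                ≤ (((ℓ + 1 : ℕ) : ℝ) ^ (K - n))⁻¹ * (c35 * (((ℓ + 1 : ℕ) : ℝ) * (((ℓ + 1) ^ a' : ℕ) : ℝ)) * α₀) * Real.exp ((((ℓ + 1 : ℕ) : ℝ) ^ (K - n))⁻¹ * (c35 * (((ℓ + 1 : ℕ) : ℝ) * (((ℓ + 1) ^ a' : ℕ) : ℝ)) * α₀))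
              ∧ ‖(((Fr (torusT (PV 2 ℓ m K hd3 hL) 0 μ (fun κ => ((z κ : ℤ) : ZMod ((PV 2 ℓ m K hd3 hL).sitesPerDir 0)))))⁻¹
                  * unitsField (toUField W) ⟨torusT (PV 2 ℓ m K hd3 hL) 0 μ (fun κ => ((z κ : ℤ) : ZMod ((PV 2 ℓ m K hd3 hL).sitesPerDir 0))), ν⟩
                  * Fr (torusT (PV 2 ℓ m K hd3 hL) 0 ν (torusT (PV 2 ℓ m K hd3 hL) 0 μ (fun κ => ((z κ : ℤ) : ZMod ((PV 2 ℓ m K hd3 hL).sitesPerDir 0))))) :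
                  (Matrix (Fin 2) (Fin 2) ℂ)ˣ) : Matrix (Fin 2) (Fin 2) ℂ) - 1‖
                ≤ (((ℓ + 1 : ℕ) : ℝ) ^ (K - n))⁻¹ * (c35 * (((ℓ + 1 : ℕ) : ℝ) * (((ℓ + 1) ^ a' : ℕ) : ℝ)) * α₀) * Real.exp ((((ℓ + 1 : ℕ) : ℝ) ^ (K - n))⁻¹ * (c35 * (((ℓ + 1 : ℕ) : ℝ) * (((ℓ + 1) ^ a' : ℕ) : ℝ)) * α₀))
              ∧ ‖(((Fr (torusT (PV 2 ℓ m K hd3 hL) 0 ν (fun κ => ((z κ : ℤ) : ZMod ((PV 2 ℓ m K hd3 hL).sitesPerDir 0)))))⁻¹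
                    * unitsField (toUField W) ⟨torusT (PV 2 ℓ m K hd3 hL) 0 ν (fun κ => ((z κ : ℤ) : ZMod ((PV 2 ℓ m K hd3 hL).sitesPerDir 0))), μ⟩
                    * Fr (torusT (PV 2 ℓ m K hd3 hL) 0 μ (torusT (PV 2 ℓ m K hd3 hL) 0 ν (fun κ => ((z κ : ℤ) : ZMod ((PV 2 ℓ m K hd3 hL).sitesPerDir 0))))) :
                    (Matrix (Fin 2) (Fin 2) ℂ)ˣ) : Matrix (Fin 2) (Fin 2) ℂ)
                  - (((Fr (fun κ => ((z κ : ℤ) : ZMod ((PV 2 ℓ m K hd3 hL).sitesPerDir 0))))⁻¹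
                    * unitsField (toUField W) ⟨(fun κ => ((z κ : ℤ) : ZMod ((PV 2 ℓ m K hd3 hL).sitesPerDir 0))), μ⟩
                    * Fr (torusT (PV 2 ℓ m K hd3 hL) 0 μ (fun κ => ((z κ : ℤ) : ZMod ((PV 2 ℓ m K hd3 hL).sitesPerDir 0)))) : (Matrix (Fin 2) (Fin 2) ℂ)ˣ) :
                    Matrix (Fin 2) (Fin 2) ℂ)‖
                ≤ (((ℓ + 1 : ℕ) : ℝ) ^ (K - n))⁻¹ * ((((ℓ + 1 : ℕ) : ℝ) ^ (K - n))⁻¹ * (c35 * (((ℓ + 1 : ℕ) : ℝ) * (((ℓ + 1) ^ a' : ℕ) : ℝ)) * α₀))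
                    * Real.exp ((((ℓ + 1 : ℕ) : ℝ) ^ (K - n))⁻¹ * (c35 * (((ℓ + 1 : ℕ) : ℝ) * (((ℓ + 1) ^ a' : ℕ) : ℝ)) * α₀)) := by
  classical
  obtain ⟨c35, a₅, hc35, ha₅, H⟩ := reg335_reg336_T3_of_regPr ℓ hL hℓ4
  refine ⟨c35, a₅, hc35, ha₅, ?_⟩
  intro hℓ m hm n K a' R hk1 hsize hM8 hR2 α₀ hα₀ hMα W hreg t
  set i := memberIdx ℓ hL hℓ m hm n K a' R hk1 hsize hM8 hR2 with hi
  -- (3.35) of the reading on the member's cube class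
  have h335 := ((reg335_bgT3_iff i c35 α₀ W).1 (H hℓ m hm n K a' R hk1 hsize hM8 hR2 α₀ hα₀ hMα W hreg c35 le_rfl).1)
  -- the big-block grid and one aligned cube of side `2B` around the window
  set B := bigSide ℓ ((ℓ + 1) ^ a') (K - n) with hB
  have hBge : 2 * (5 * (PV 2 ℓ m K hd3 hL).L ^ (K - n) + 1) + 4 ≤ B := bigSide_ge_window (K := K) (n := n) hℓ hM8
  have hBpos : 0 < B := by omega
  have hBN : B ∣ (PV 2 ℓ m K hd3 hL).sitesPerDir 0 := bigSide_dvd_sitesPerDir (hL := hL) hℓ m n K a' hk1 hsize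
  have h2B2 : 2 * (2 * B) + 2 ≤ (PV 2 ℓ m K hd3 hL).sitesPerDir 0 := two_mul_side_add_two_le (hL := hL) hℓ m n K a' hk1 hsize (n' := 2) (by norm_num)
  have h2B : 2 * B ≤ (PV 2 ℓ m K hd3 hL).sitesPerDir 0 := by omega
  obtain ⟨c, hc, hcov⟩ := exists_gridCube_cover_box (P := PV 2 ℓ m K hd3 hL) B hBpos hBN h2B
    (fun μ : Fin (PV 2 ℓ m K hd3 hL).d => ((((PV 2 ℓ m K hd3 hL).L ^ (K - n) - 1) / 2 : ℕ) : ℤ) + (((PV 2 ℓ m K hd3 hL).L ^ (K - n) : ℕ) : ℤ) * t μ)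
    (5 * (PV 2 ℓ m K hd3 hL).L ^ (K - n) + 1) hBge
  have hq := gridCube_mem_cubeClass396 (hL := hL) hℓ m hm n K a' R hk1 hsize hM8 hR2 c hc
  have hη : 0 < (kGeo i).eta := (eta_pos_L_one_le_M_pos i).1
  have hReg : Reg335Cube (torusT (PV 2 ℓ m K hd3 hL) 0) (fun κ z => unitsField (toUField W) ⟨z, κ⟩) (kGeo i).eta (torusCube c (2 * B))
      (scaleLen ((ℓ + 1 : ℕ) : ℝ) (kGeo i).eta (K - n)) (c35 * (kGeo i).M * α₀) := h335 _ hq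
  obtain ⟨u, hu, hsize', hmixed⟩ := frame_rows_of_reg335Cube_mixed (torusT (PV 2 ℓ m K hd3 hL) 0) (fun κ z => unitsField (toUField W) ⟨z, κ⟩) hη hReg
  -- the constants: `ξ = 1`, `η = L^{−(K−n)}`, `M = L·L^{a′}`
  have hξ : scaleLen ((ℓ + 1 : ℕ) : ℝ) (kGeo i).eta (K - n) = 1 := scaleLen_eta_memberIdx (hL := hL) hℓ m hm n K a' R hk1 hsize hM8 hR2
  have hηe : (kGeo i).eta = ((((ℓ + 1 : ℕ) : ℝ)) ^ (K - n))⁻¹ := eta_memberIdx hℓ m hm n K a' R hk1 hsize hM8 hR2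
  have hMe : (kGeo i).M = ((ℓ + 1 : ℕ) : ℝ) * (((ℓ + 1) ^ a' : ℕ) : ℝ) := M_memberIdx hℓ m hm n K a' R hk1 hsize hM8 hR2
  rw [hξ, inv_one, mul_one, hηe, hMe] at hsize'
  rw [hξ, one_pow, inv_one, mul_one, hηe, hMe] at hmixed
  -- the frame: `u⁻¹` on the cube, `1` outside
  refine ⟨fun z => if z ∈ torusCube c (2 * B) then (u z)⁻¹ else 1, piecewiseFrame_bicontr (torusCube c (2 * B)) u hu, ?_⟩
  intro z hz μ ν
  -- the five points of the rows, all in the cube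
  set N := (PV 2 ℓ m K hd3 hL).sitesPerDir 0 with hN
  have hcast : ∀ e : Zd (PV 2 ℓ m K hd3 hL).d, (∀ κ, 0 ≤ e κ ∧ e κ ≤ 2) → (fun κ => (((z + e) κ : ℤ) : ZMod N)) ∈ torusCube c (2 * B) :=
    fun e he => hcov z (by exact_mod_cast hz) e he
  have hx0 : (fun κ => ((z κ : ℤ) : ZMod N)) ∈ torusCube c (2 * B) := by
    have := hcast 0 (fun κ => by simp); simpa using this
  have hx1 : ∀ κ' : Fin (PV 2 ℓ m K hd3 hL).d, torusT (PV 2 ℓ m K hd3 hL) 0 κ' (fun κ => ((z κ : ℤ) : ZMod N)) ∈ torusCube c (2 * B) := by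
    intro κ'
    rw [torusT_intCast]
    exact hcast (unitVec κ') (unitVec_mem κ')
  have hx2 : ∀ κ₁ κ₂ : Fin (PV 2 ℓ m K hd3 hL).d,
      torusT (PV 2 ℓ m K hd3 hL) 0 κ₂ (torusT (PV 2 ℓ m K hd3 hL) 0 κ₁ (fun κ => ((z κ : ℤ) : ZMod N))) ∈ torusCube c (2 * B) := by
    intro κ₁ κ₂
    rw [torusT_intCast, torusT_intCast, add_assoc]
    exact hcast (unitVec κ₁ + unitVec κ₂) (unitVec_add_mem κ₁ κ₂)
  -- the frame holonomy inside the cube is the gauge-transformed bond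
  have hhol : ∀ (κ' : Fin (PV 2 ℓ m K hd3 hL).d) (x : Site (PV 2 ℓ m K hd3 hL) 0), x ∈ torusCube c (2 * B) → torusT (PV 2 ℓ m K hd3 hL) 0 κ' x ∈ torusCube c (2 * B) →
      ((fun z => if z ∈ torusCube c (2 * B) then (u z)⁻¹ else 1) x)⁻¹ * unitsField (toUField W) ⟨x, κ'⟩
          * (fun z => if z ∈ torusCube c (2 * B) then (u z)⁻¹ else 1) (torusT (PV 2 ℓ m K hd3 hL) 0 κ' x)
        = gaugeTr (torusT (PV 2 ℓ m K hd3 hL) 0) u (fun κ z => unitsField (toUField W) ⟨z, κ⟩) κ' x :=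
    fun κ' x hx hTx => piecewiseFrameHol_eq (torusT (PV 2 ℓ m K hd3 hL) 0) (fun κ z => unitsField (toUField W) ⟨z, κ⟩) (torusCube c (2 * B)) u κ' x hx hTx
  refine ⟨?_, ?_, ?_, ?_⟩
  · rw [hhol ν _ hx0 (hx1 ν)]; exact hsize' ν _ hx0
  · rw [hhol μ _ hx0 (hx1 μ)]; exact hsize' μ _ hx0
  · rw [hhol ν _ (hx1 μ) (hx2 μ ν)]; exact hsize' ν _ (hx1 μ)
  · rw [hhol μ _ (hx1 ν) (hx2 ν μ), hhol μ _ hx0 (hx1 μ)]; exact hmixed ν μ _ hx0 (hx1 ν)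


/-- ★★★ **(D1-cov) AT THE MEMBER OF RECORD — THE CENTRE-PINNED `H²` POINCARÉ INEQUALITY FOR `Δ_W` WITH THE FRAMES DISCHARGED.**  ✓ `Prop7CentrePinnedHessianPoincareCov.sum_hs_le_covLaplace_hs`
at `P := PV 2 ℓ m K`, `k := K − n`, `U := unitsField (toUField W)` (unitary by ✓ `unitsField_mem_unitaryUnits`), `N := 2`, `hframes := hframes_of_regPr`: for `W ∈ RegPr` with `M·α₀ ≤ a₅`,
plaquettes within `a` of `1`, `e` vanishing on the `(K−n)`-centres and the ℓ_k-free window in `(a, τ₁, τ₂)` (`τ₁ = ηC′e^{ηC′}`, `τ₂ = η(ηC′)e^{ηC′}` as in `hframes_of_regPr`):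
`Σ_x hs(e x) ≤ 2(κ₁ℓ_k⁴ + (κ₁ℓ_k⁴(2da + 8dτ₁²))²)·Σ_x hs(Δ_We x)`.  Displayed: `hplaq` (the (6)(e) plaquette datum in `plaqU` letters) and `hwin`.
[cite: Giaquinta1984, Ch. III §1 Thm 1.2 pp.70–72; Balaban1985Variational, (135) p.298, Prop. 7 p.299; Balaban1985BackgroundPropagators, (3.35) p.396] -/
theorem sum_hs_le_covLaplace_hs_of_regPr (hℓ4 : 4 ≤ ℓ) :
    ∃ c35 a₅ : ℝ, 0 < c35 ∧ 0 < a₅ ∧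
      ∀ (hℓ : 4 ≤ ℓ) (m : ℕ) (hm : 1 ≤ m) (n K a' R : ℕ) (hk1 : 1 ≤ K - n) (hsize : a' + 3 ≤ m + n) (hM8 : 8 ≤ (ℓ + 1) ^ a')
        (hR2 : 2 * (ℓ + 1) ^ 2 ≤ R) (α₀ : ℝ), 0 < α₀ → ((ℓ + 1 : ℕ) : ℝ) * (((ℓ + 1) ^ a' : ℕ) : ℝ) * α₀ ≤ a₅ →
        ∀ W : GaugeField (PV 2 ℓ m K hd3 hL) 0 (Matrix.specialUnitaryGroup (Fin 2) ℂ),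
          RegPr (⟨ℓ + 1, hL, m, hm⟩ : T3Family) n K α₀ W →
          ∀ {a : ℝ}, (∀ (μ ν : Fin (PV 2 ℓ m K hd3 hL).d) (x : Site (PV 2 ℓ m K hd3 hL) 0),
              ‖(plaqU (torusT (PV 2 ℓ m K hd3 hL) 0) (fun κ z => unitsField (toUField W) ⟨z, κ⟩) μ ν x : Matrix (Fin 2) (Fin 2) ℂ) - 1‖ ≤ a) →
          ∀ (e : Site (PV 2 ℓ m K hd3 hL) 0 → Matrix (Fin 2) (Fin 2) ℂ), (∀ y : Site (PV 2 ℓ m K hd3 hL) (K - n), e (embIter (K - n) y) = 0) →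
          (4 * 2197 * (24 * 289 * 24576 * 46116) : ℝ) * ((2 : ℕ) : ℝ) ^ 2 * ((((PV 2 ℓ m K hd3 hL).L : ℝ)) ^ (K - n)) ^ 4
              * ((((PV 2 ℓ m K hd3 hL).d : ℝ)) ^ 2 * (4 * ((2 : ℕ) : ℝ) * a ^ 2
                + (2 * ((((ℓ + 1 : ℕ) : ℝ) ^ (K - n))⁻¹ * ((((ℓ + 1 : ℕ) : ℝ) ^ (K - n))⁻¹ * (c35 * (((ℓ + 1 : ℕ) : ℝ) * (((ℓ + 1) ^ a' : ℕ) : ℝ)) * α₀))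
                    * Real.exp ((((ℓ + 1 : ℕ) : ℝ) ^ (K - n))⁻¹ * (c35 * (((ℓ + 1 : ℕ) : ℝ) * (((ℓ + 1) ^ a' : ℕ) : ℝ)) * α₀)))
                  + 4 * ((((ℓ + 1 : ℕ) : ℝ) ^ (K - n))⁻¹ * (c35 * (((ℓ + 1 : ℕ) : ℝ) * (((ℓ + 1) ^ a' : ℕ) : ℝ)) * α₀)
                    * Real.exp ((((ℓ + 1 : ℕ) : ℝ) ^ (K - n))⁻¹ * (c35 * (((ℓ + 1 : ℕ) : ℝ) * (((ℓ + 1) ^ a' : ℕ) : ℝ)) * α₀))) ^ 2) ^ 2)) ≤ 1 / 4 →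
          ∑ x : Site (PV 2 ℓ m K hd3 hL) 0, ∑ j : Fin 2, ∑ k' : Fin 2, ‖(e x) j k'‖ ^ 2
            ≤ 2 * ((4 * 2197 * (24 * 289 * 24576 * 46116) : ℝ) * ((2 : ℕ) : ℝ) ^ 2 * ((((PV 2 ℓ m K hd3 hL).L : ℝ)) ^ (K - n)) ^ 4
                  + ((4 * 2197 * (24 * 289 * 24576 * 46116) : ℝ) * ((2 : ℕ) : ℝ) ^ 2 * ((((PV 2 ℓ m K hd3 hL).L : ℝ)) ^ (K - n)) ^ 4
                    * (2 * (PV 2 ℓ m K hd3 hL).d * a + 8 * (PV 2 ℓ m K hd3 hL).d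
                      * ((((ℓ + 1 : ℕ) : ℝ) ^ (K - n))⁻¹ * (c35 * (((ℓ + 1 : ℕ) : ℝ) * (((ℓ + 1) ^ a' : ℕ) : ℝ)) * α₀)
                        * Real.exp ((((ℓ + 1 : ℕ) : ℝ) ^ (K - n))⁻¹ * (c35 * (((ℓ + 1 : ℕ) : ℝ) * (((ℓ + 1) ^ a' : ℕ) : ℝ)) * α₀))) ^ 2)) ^ 2)
              * ∑ x : Site (PV 2 ℓ m K hd3 hL) 0, ∑ j : Fin 2, ∑ k' : Fin 2,
                  ‖(divB (torusT (PV 2 ℓ m K hd3 hL) 0) (fun κ z => unitsField (toUField W) ⟨z, κ⟩)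
                      (fun κ => covD (torusT (PV 2 ℓ m K hd3 hL) 0) (fun κ z => unitsField (toUField W) ⟨z, κ⟩) κ e) x) j k'‖ ^ 2 := by
  obtain ⟨c35, a₅, hc35, ha₅, H⟩ := hframes_of_regPr (hL := hL) hℓ4
  refine ⟨c35, a₅, hc35, ha₅, ?_⟩
  intro hℓ m hm n K a' R hk1 hsize hM8 hR2 α₀ hα₀ hMα W hreg a hplaq e he0 hwin
  have hU : ∀ (ν : Fin (PV 2 ℓ m K hd3 hL).d) (x : Site (PV 2 ℓ m K hd3 hL) 0),
      (((fun κ z => unitsField (toUField W) ⟨z, κ⟩) ν x : (Matrix (Fin 2) (Fin 2) ℂ)ˣ) : Matrix (Fin 2) (Fin 2) ℂ) ∈ unitary (Matrix (Fin 2) (Fin 2) ℂ) :=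
    fun ν x => B7Prop2Explicit.mem_unitaryUnits.mp (B10Eq27TorusAxialLog.unitsField_mem_unitaryUnits (toUField W) ⟨x, ν⟩)
  exact sum_hs_le_covLaplace_hs (P := PV 2 ℓ m K hd3 hL) (N := 2) rfl (hkw ℓ hL m n K) hU hplaq e he0
    (H hℓ m hm n K a' R hk1 hsize hM8 hR2 α₀ hα₀ hMα W hreg) hwin

end Member

end Summit.QuantumFields.YangMills.Theorems.Prop7CentrePinnedHessianPoincareCovFrames

end
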